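import Literature.IUT.HodgeTheaters.PMBaseBridgePropsProofs2

/-!
# Proofs over [IUTchI] Ex 6.3 (ii): equivariance of `φ^{Θell}_±` for negative elements, characterised

Mochizuki, *Inter-universal Teichmüller theory I*, §6, Example 6.3 (ii) p. 161 ("One verifies immediately
that `φ^{Θell}_±` is equivariant with respect to these poly-actions of `𝔽_l^{⋊±}`"), kurims manuscript
(May 2020). PROOF-ONLY companion (theorems, no definitions) to abc-iut-L5-t4's `PMBaseModels.lean`, by
the L5 discharge seat abc-iut-L5-t13.

**Ex 6.3 (ii), negative elements — REDUCED to one compatibility of `φ^{Θell}_{•,v}`**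
(`Ex63.equivariant_of_negCompat`): the equivariance `Ex63.Equivariant K γ` for EVERY negative
`γ ∈ 𝔽_l^{⋊±}` follows from the single condition that, at each `v`, some NEGATIVE automorphism of `𝒟_v`
(one acting by `−1` on `LabCusp^±(𝒟_v)`) is intertwined by `φ^{Θell}_{•,v} : 𝒟_v → 𝒟^{⊚±}` with a lift of
`(0, −1) ∈ 𝔽_l^{⋊±}` to `Aut_±(𝒟^{⊚±})` — geometrically: the hyperelliptic-type involution of `X_K`
restricts to `−1` on the cusps of `X→_v` (cf. Def 6.1 (v), Rmk 6.1.1). The base interface `PMBaseKit`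
records `φ^{Θell}_{•,v}` only through its effect on label classes, so this condition is exactly what the
conditional discharges of Props 6.6 (ii), (iii), 6.8 (i), Rmk 6.12.1 (`…Proofs5`, `…Proofs9`,
`ThetaPMEllHodgeTheatersProofs`) assume, in the form `∀ γ, γ.IsNegative → Ex63.Equivariant K γ`.
Record only; [claim: Mochizuki2012, status: disputed]; nothing here takes a side on any disputed step.
-/

namespace Literature.IUT.HodgeTheaters

open CategoryTheory

universe u

namespace PMBaseKit

variable {l : ℕ} {K : PMBaseKit.{u} l}

namespace Ex63

/-- Lifts depend only on the induced permutation of `𝔽_l`. [claim: Mochizuki2012, status: disputed] -/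
theorem lifts_eq_of_toPerm_eq {g g' : FlPM l} (h : FlPM.toPerm l g = FlPM.toPerm l g') :
    lifts K g = lifts K g' := by
  unfold lifts
  rw [h]

/-- **[IUTchI] Ex 6.3 (ii) for NEGATIVE elements, from the `[−1]`-compatibility of `φ^{Θell}_{•,v}`**:
if at every `v` some negative automorphism `a` of `𝒟_v` and some lift `b` of `(0, −1)` satisfy
`a ≫ φ^{Θell}_{•,v} = φ^{Θell}_{•,v} ≫ b`, then `φ^{Θell}_±` is equivariant for every negative
`γ ∈ 𝔽_l^{⋊±}` (p. 161). [claim: Mochizuki2012, status: disputed] -/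
theorem equivariant_of_negCompat
    (hneg : ∀ v, ∃ a : K.model v ≅ K.model v, K.labMap v a = labNeg (K.isLocal_model v) ∧
      ∃ b ∈ lifts K (FlPM.mk 0 (-1)), a.hom ≫ K.phiEll v = K.phiEll v ≫ (K.atV v).map b.hom)
    {γ : FlPM l} (hγ : γ.IsNegative) : Equivariant K γ := by
  intro t v
  obtain ⟨a, ha, b₀, hb₀, hcomp⟩ := hneg v
  have hγr : γ.right = -1 := hγ
  change {h | ∃ f ∈ poly K t v, ∃ b ∈ lifts K γ, h = f ≫ (K.atV v).map b.hom} =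
    {h | ∃ p ∈ (DStrip.model K).signedPolyAut (fun _ => γ.right),
      ∃ g ∈ poly K (γ • t) v, h = (p v).hom ≫ g}
  rw [hγr]
  -- the two permutation identities behind the bookkeeping of lifts
  have hperm₁ : FlPM.toPerm l (γ * (FlPM.transl t * FlPM.mk 0 (-1))) = FlPM.toPerm l (FlPM.transl (γ • t)) := by
    ext z
    simp only [map_mul, Equiv.Perm.mul_apply, FlPM.toPerm_apply, FlPM.mk_smul, FlPM.transl_smul,
      FlPM.smul_def γ, hγr, Units.neg_smul, one_smul, add_zero]
    ring
  have hperm₂ : FlPM.toPerm l (FlPM.transl (γ • t) * ((FlPM.mk 0 (-1))⁻¹ * (FlPM.transl t)⁻¹)) =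
      FlPM.toPerm l γ := by
    ext z
    have h1 : (FlPM.toPerm l (FlPM.transl t)).symm z = z - t := by
      rw [Equiv.symm_apply_eq]; simp [FlPM.transl_smul]
    have h2 : (FlPM.toPerm l (FlPM.mk (l := l) 0 (-1))).symm (z - t) = -(z - t) := by
      rw [Equiv.symm_apply_eq]; simp [FlPM.mk_smul]
    simp only [map_mul, map_inv, Equiv.Perm.mul_apply, Equiv.Perm.inv_def, h1, h2, FlPM.toPerm_apply,
      FlPM.transl_smul, FlPM.smul_def γ, hγr, Units.neg_smul, one_smul]
    ring
  -- `a⁻¹ ≫ φ = φ ≫ b₀⁻¹`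
  have hcomp' : a.inv ≫ K.phiEll v = K.phiEll v ≫ (K.atV v).map b₀.inv := by
    rw [← cancel_epi a.hom, ← Category.assoc, a.hom_inv_id, Category.id_comp, ← Category.assoc, hcomp,
      Category.assoc, ← Functor.map_comp, Iso.hom_inv_id, CategoryTheory.Functor.map_id, Category.comp_id]
  ext h
  constructor
  · rintro ⟨f, ⟨ap, hap, bt, hbt, rfl⟩, b, hb, rfl⟩
    -- `a⁺ φ b_t b = (a⁺ a⁻¹) ≫ (φ ≫ b₀ b_t b)`
    have hapv : K.labMap v ap = Equiv.refl _ := (K.mem_autPlus_iff ap).mp hap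
    obtain ⟨s, hs⟩ := DStrip.exists_mem_signedPolyAut (DStrip.model K) (fun _ => (-1 : ℤˣ))
    -- the negative strip automorphism `s` adjusted at `v` is not needed: use the coset description
    have hmem : b₀ ≪≫ bt ≪≫ b ∈ lifts K (FlPM.transl (γ • t)) := by
      rw [← lifts_eq_of_toPerm_eq hperm₁]
      have h := trans_mem_lifts (trans_mem_lifts hb₀ hbt) hb
      simpa only [Iso.trans_assoc] using h
    -- a negative `+`-full poly-automorphism of the model strip through `ap ≪≫ a.symm` at `v`
    have hneg_v : K.labMap v (ap ≪≫ a.symm) = labNeg (K.isLocal_model v) := by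
      rw [K.labMap_trans, hapv, Equiv.refl_trans, labMap_symm, ha]
      ext x
      rw [Equiv.symm_apply_eq]
      have := congrArg (fun e => e x) (labNeg_trans_labNeg (K.isLocal_model v))
      simpa using this.symm
    obtain ⟨p, hp, hpv⟩ : ∃ p ∈ (DStrip.model K).signedPolyAut (fun _ => (-1 : ℤˣ)), p v = ap ≪≫ a.symm := by
      classical
      refine ⟨fun w => if hw : w = v then hw ▸ (ap ≪≫ a.symm) else s w, ?_, by simp⟩
      rw [DStrip.mem_signedPolyAut_iff] at hs ⊢
      intro w
      by_cases hw : w = v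
      · subst hw
        simp only [dite_true]
        rw [hneg_v]
        exact ⟨fun h => absurd h (labNeg_ne_refl _), fun h => absurd h (by decide)⟩
      · simp only [hw, dite_false]
        exact hs w
    refine ⟨p, hp, K.phiEll v ≫ (K.atV v).map (b₀ ≪≫ bt ≪≫ b).hom,
      ⟨Iso.refl _, (K.mem_autPlus_iff _).mpr (K.labMap_refl v _), _, hmem, by simp⟩, ?_⟩
    rw [hpv]
    simp only [Iso.trans_hom, Iso.symm_hom, Functor.map_comp, Category.assoc]
    rw [reassoc_of% hcomp']
    simp only [Iso.map_inv_hom_id_assoc]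
  · rintro ⟨p, hp, g, ⟨ap, hap, b'', hb'', rfl⟩, rfl⟩
    have hpv : K.labMap v (p v) = labNeg (K.isLocal_model v) := by
      have := (DStrip.mem_signedPolyAut_iff _ _).mp hp v
      rcases labMap_eq_refl_or_labNeg (K.isLocal_model v) (p v) with h | h
      · exact absurd (this.mp h) (by decide)
      · exact h
    have hapv : K.labMap v ap = Equiv.refl _ := (K.mem_autPlus_iff ap).mp hap
    obtain ⟨bt, hbt⟩ := lifts_nonempty (K := K) (FlPM.transl t)
    -- `q := p_v ≫ a⁺ ≫ a` is positive
    have hq : K.labMap v (((p v : K.model v ≅ K.model v) ≪≫ (ap : K.model v ≅ K.model v)) ≪≫ a) =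
        Equiv.refl _ := by
      rw [K.labMap_trans, K.labMap_trans, hpv, hapv, ha, Equiv.trans_refl, labNeg_trans_labNeg]
    have hb : bt.symm ≪≫ b₀.symm ≪≫ b'' ∈ lifts K γ := by
      rw [← lifts_eq_of_toPerm_eq hperm₂]
      have h := trans_mem_lifts (trans_mem_lifts (symm_mem_lifts hbt) (symm_mem_lifts hb₀)) hb''
      simpa only [Iso.trans_assoc] using h
    refine ⟨(((p v : K.model v ≅ K.model v) ≪≫ (ap : K.model v ≅ K.model v)) ≪≫ a).hom ≫ K.phiEll v ≫
        (K.atV v).map bt.hom,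
      ⟨((p v : K.model v ≅ K.model v) ≪≫ (ap : K.model v ≅ K.model v)) ≪≫ a, (K.mem_autPlus_iff _).mpr hq,
        bt, hbt, rfl⟩, _, hb, ?_⟩
    simp only [Iso.trans_hom, Iso.symm_hom, Functor.map_comp, Category.assoc]
    rw [reassoc_of% hcomp]
    simp only [Iso.map_hom_inv_id_assoc]

end Ex63

end PMBaseKit

end Literature.IUT.HodgeTheaters
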